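import Summits.CriticalPhenomena.SAWScalingLimit.Theorems.SAWDefectDecoherenceBoundaryClosureRRootWedgeChain
import Summits.CriticalPhenomena.SAWScalingLimit.Theorems.SAWDefectDecoherenceBoundaryClosureRBoundaryBookkeepingPath
import HarnessLib

/-!
# Developing maps: uniqueness of potentials and the interior local link (crux `BoundaryClosureR`,
stmt-CriticalPhenomena-14004, line `pick-half-plane`, stub `stub_developingMapsCompact`)

Support file (topic: two lattice-side inputs of the compactness of the normalised developing maps
`h_δ = δ (H − H(s_b))/F(b δ)`, `H` a potential of `F dz` (Duminil-Copin–Smirnov 2012, §4)):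

* `sub_eq_sub_of_preconnected`: on a connected domain two potentials differ by a constant on the
  lattice sites (the increment across every edge of a face of `Λ` is prescribed; walk induction);
* `interior_link` / `interior_density`: near a point of an open region whose compacts are exhausted
  by the domains and carry the local sup law, the equi-Lipschitz estimate
  `‖δ(H s' − H s)/F(b δ)‖ ≤ C(‖δ s' − δ s‖ + δ)` at all sites (the landed `core_link`), and lattice
  sites within any `θ > 0` of the point, eventually.
-/

noncomputable section

open scoped Topology
open Filter Set
open Literature.Probability.LatticeModels Literature.Probability.RandomPlanarGeometry
open Literature.Probability.RandomPlanarGeometry.SAW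
open Summit.CriticalPhenomena.SAWScalingLimit.Theorems.PickHalfPlane.RootWedge
open Summit.CriticalPhenomena.SAWScalingLimit.Theorems.PickHalfPlane.BoundaryExactness
  (orient_swap orient_ne_zero)

namespace Summit.CriticalPhenomena.SAWScalingLimit.Theorems.PickHalfPlane.DevelopingMaps

/-! ### Potentials are unique up to constants on connected domains -/

/-- Two potentials have the same increment across a lattice edge of a face of `Λ` dual to a
hexagonal edge. [cite: DuminilCopinSmirnov2012, §4 (the map H with dH = F dz)] -/
theorem sub_eq_sub_of_adj {Λ : Finset HexVertex} {a : Sym2 HexVertex} {H H' : Site 2 → ℂ}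
    (hH : IsPotential Λ a H) (hH' : IsPotential Λ a H') {v t : HexVertex} (hv : v ∈ Λ)
    (hvt : hexGraph.Adj v t) {p q : Site 2} (hpv : p ∈ hexFaceVertices v)
    (hpt : p ∈ hexFaceVertices t) (hqv : q ∈ hexFaceVertices v) (hqt : q ∈ hexFaceVertices t) :
    H q - H' q = H p - H' p := by
  by_cases hpq : p = q
  · rw [hpq]
  rcases lt_trichotomy 0
      ((starRingEnd ℂ) (triEmbed q - triEmbed p) * (hexCenter v - triEmbed p)).im with h | h | h
  · have e1 := hH v hv t hvt p q hpv hqv hpt hqt hpq h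
    have e2 := hH' v hv t hvt p q hpv hqv hpt hqt hpq h
    linear_combination e1 - e2
  · exact absurd h.symm (orient_ne_zero hpv hqv hpq)
  · have h' : 0 < ((starRingEnd ℂ) (triEmbed p - triEmbed q) * (hexCenter v - triEmbed q)).im := by
      rw [orient_swap]; linarith
    have e1 := hH v hv t hvt q p hqv hpv hqt hpt (Ne.symm hpq) h'
    have e2 := hH' v hv t hvt q p hqv hpv hqt hpt (Ne.symm hpq) h'
    linear_combination e2 - e1

/-- Two potentials differ by a constant on the three vertices of a face of `Λ`.
[cite: DuminilCopinSmirnov2012, §4 (the map H with dH = F dz)] -/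
theorem sub_eq_sub_of_mem_face {Λ : Finset HexVertex} {a : Sym2 HexVertex} {H H' : Site 2 → ℂ}
    (hH : IsPotential Λ a H) (hH' : IsPotential Λ a H') {v : HexVertex} (hv : v ∈ Λ)
    {p q : Site 2} (hp : p ∈ hexFaceVertices v) (hq : q ∈ hexFaceVertices v) :
    H q - H' q = H p - H' p := by
  obtain ⟨y, k⟩ := v
  have hk : k = 0 ∨ k = 1 := by
    rcases Fin.exists_fin_two.1 ⟨k, rfl⟩ with h | h
    · exact Or.inl h
    · exact Or.inr h
  rcases hk with rfl | rfl
  · -- up face: `y ∼ y + e₀` across `(y - e₁, 1)`, `y + e₀ ∼ y + e₁` across `(y, 1)`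
    have h01 : H (y + Pi.single 0 1) - H' (y + Pi.single 0 1) = H y - H' y :=
      sub_eq_sub_of_adj hH hH' hv
        ((hexGraph_adj_iff_of_snd_eq_zero_holds y (y - Pi.single 1 1)).2 (Or.inr (Or.inr rfl)))
        (mem_hexFaceVertices_zero.2 (Or.inl rfl))
        (mem_hexFaceVertices_one.2 (Or.inr (Or.inl (by abel))))
        (mem_hexFaceVertices_zero.2 (Or.inr (Or.inl rfl)))
        (mem_hexFaceVertices_one.2 (Or.inr (Or.inr (by abel))))
    have h12 : H (y + Pi.single 1 1) - H' (y + Pi.single 1 1) =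
        H (y + Pi.single 0 1) - H' (y + Pi.single 0 1) :=
      sub_eq_sub_of_adj hH hH' hv ((hexGraph_adj_iff_of_snd_eq_zero_holds y y).2 (Or.inl rfl))
        (mem_hexFaceVertices_zero.2 (Or.inr (Or.inl rfl))) (mem_hexFaceVertices_one.2 (Or.inl rfl))
        (mem_hexFaceVertices_zero.2 (Or.inr (Or.inr rfl)))
        (mem_hexFaceVertices_one.2 (Or.inr (Or.inl rfl)))
    have key : ∀ s ∈ hexFaceVertices ((y, 0) : HexVertex), H s - H' s = H y - H' y := by
      intro s hs
      rcases mem_hexFaceVertices_zero.1 hs with rfl | rfl | rfl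
      · rfl
      · exact h01
      · exact h12.trans h01
    rw [key q hq, key p hp]
  · -- down face: `y + e₀ ∼ y + e₁` across `(y, 0)`, `y + e₀ ∼ y + e₀ + e₁` across `(y + e₀, 0)`
    have h01 : H (y + Pi.single 1 1) - H' (y + Pi.single 1 1) =
        H (y + Pi.single 0 1) - H' (y + Pi.single 0 1) :=
      sub_eq_sub_of_adj hH hH' hv ((hexGraph_adj_iff_of_snd_eq_one y y).2 (Or.inl rfl))
        (mem_hexFaceVertices_one.2 (Or.inl rfl)) (mem_hexFaceVertices_zero.2 (Or.inr (Or.inl rfl)))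
        (mem_hexFaceVertices_one.2 (Or.inr (Or.inl rfl)))
        (mem_hexFaceVertices_zero.2 (Or.inr (Or.inr rfl)))
    have h02 : H (y + (Pi.single 0 1 + Pi.single 1 1)) - H' (y + (Pi.single 0 1 + Pi.single 1 1)) =
        H (y + Pi.single 0 1) - H' (y + Pi.single 0 1) :=
      sub_eq_sub_of_adj hH hH' hv
        ((hexGraph_adj_iff_of_snd_eq_one y (y + Pi.single 0 1)).2 (Or.inr (Or.inl rfl)))
        (mem_hexFaceVertices_one.2 (Or.inl rfl)) (mem_hexFaceVertices_zero.2 (Or.inl rfl))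
        (mem_hexFaceVertices_one.2 (Or.inr (Or.inr rfl)))
        (mem_hexFaceVertices_zero.2 (Or.inr (Or.inr (by abel))))
    have key : ∀ s ∈ hexFaceVertices ((y, 1) : HexVertex),
        H s - H' s = H (y + Pi.single 0 1) - H' (y + Pi.single 0 1) := by
      intro s hs
      rcases mem_hexFaceVertices_one.1 hs with rfl | rfl | rfl
      · rfl
      · exact h01
      · exact h02
    rw [key q hq, key p hp]

/-- Along a walk of faces of `Λ`, two potentials keep the same difference.
[cite: DuminilCopinSmirnov2012, §4 (the map H with dH = F dz)] -/
theorem sub_eq_sub_of_walk {Λ : Finset HexVertex} {a : Sym2 HexVertex} {H H' : Site 2 → ℂ}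
    (hH : IsPotential Λ a H) (hH' : IsPotential Λ a H') :
    ∀ {u v : ((Λ : Finset HexVertex) : Set HexVertex)}
      (_ : (hexGraph.induce ((Λ : Finset HexVertex) : Set HexVertex)).Walk u v) {p q : Site 2},
      p ∈ hexFaceVertices u.1 → q ∈ hexFaceVertices v.1 → H q - H' q = H p - H' p
  | u, _, .nil, _, _, hp, hq => sub_eq_sub_of_mem_face hH hH' u.2 hp hq
  | u, _, .cons (v := r) h W, p, q, hp, hq => by
    obtain ⟨z, hzu, hzr⟩ :=
      exists_mem_inter_of_card_eq_two ((hexGraph_adj_iff _ _).1 (SimpleGraph.induce_adj.1 h)).2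
    rw [sub_eq_sub_of_walk hH hH' W hzr hq]
    exact sub_eq_sub_of_mem_face hH hH' u.2 hp hzu

/-- **Potentials are unique up to constants on connected domains**: if the faces of `Λ` form a
connected subgraph of `ℍ`, two potentials of the same observable have the same increments
between any two lattice sites of `Λ`. [cite: DuminilCopinSmirnov2012, §4 (the map H with dH = F dz)] -/
theorem sub_eq_sub_of_preconnected {Λ : Finset HexVertex} {a : Sym2 HexVertex} {H H' : Site 2 → ℂ}
    (hΛ : (hexGraph.induce ((Λ : Finset HexVertex) : Set HexVertex)).Preconnected)
    (hH : IsPotential Λ a H) (hH' : IsPotential Λ a H') {s t : Site 2} (hs : IsLatticeSite Λ s)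
    (ht : IsLatticeSite Λ t) : H t - H s = H' t - H' s := by
  obtain ⟨f, hf, hsf⟩ := hs
  obtain ⟨g, hg, htg⟩ := ht
  obtain ⟨W⟩ := hΛ ⟨f, hf⟩ ⟨g, hg⟩
  have := sub_eq_sub_of_walk hH hH' W hsf htg
  linear_combination this

/-! ### Near a point of the open region: the local link and density -/

/-- A site is a vertex of the up-face of its own cell. [folklore] -/
theorem mem_hexFaceVertices_upFace (s : Site 2) : s ∈ hexFaceVertices (upFace (s 0) (s 1)) := by
  have hsv : s = ![s 0, s 1] := by ext i; fin_cases i <;> simp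
  unfold upFace
  rw [mem_hexFaceVertices_zero]
  exact Or.inl hsv

/-- **The local link near a point of the open region.**  If `Ω` is open, its compacts are
eventually exhausted by the faces of `Λ δ`, and the local sup law holds on compacts of `Ω`, then
near every `z ∈ Ω`: for ONE `η > 0` and `C ≥ 0`, eventually, for every potential `H`,
`‖δ (H s' − H s)/F(b δ)‖ ≤ C (‖δ s' − δ s‖ + δ)` for all sites `s, s'` within `η` of `z`
(the landed `core_link` in `closedBall z (40η) ⊆ Ω`). [cite: DuminilCopinSmirnov2012, §4 (the map H with dH = F dz)] -/
theorem interior_link {Λ : ℝ → Finset HexVertex} {e b : ℝ → Sym2 HexVertex} {Ω : Set ℂ}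
    (hΩ : IsOpen Ω)
    (hexh : ∀ K : Set ℂ, IsCompact K → K ⊆ Ω →
      ∀ᶠ δ : ℝ in 𝓝[>] 0, ∀ v : HexVertex, (δ : ℂ) * hexCenter v ∈ K → v ∈ Λ δ)
    (hSup : ∀ K : Set ℂ, IsCompact K → K ⊆ Ω →
      ∃ C : ℝ, ∀ᶠ δ : ℝ in 𝓝[>] 0, ∀ w ∈ hexDomainMidEdges (Λ δ), (δ : ℂ) * hexMidpoint w ∈ K →
        ‖hexParafermionicObservable (Λ δ) (e δ) hexCriticalFugacity (5 / 8) w‖ ≤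
          C * ‖hexParafermionicObservable (Λ δ) (e δ) hexCriticalFugacity (5 / 8) (b δ)‖)
    {z : ℂ} (hz : z ∈ Ω) :
    ∃ η C : ℝ, 0 < η ∧ 0 ≤ C ∧ ∀ᶠ δ : ℝ in 𝓝[>] 0, ∀ H : Site 2 → ℂ, IsPotential (Λ δ) (e δ) H →
      ∀ s s' : Site 2, ‖(δ : ℂ) * triEmbed s - z‖ ≤ η → ‖(δ : ℂ) * triEmbed s' - z‖ ≤ η →
        ‖(δ : ℂ) * (H s' - H s) / hexParafermionicObservable (Λ δ) (e δ) hexCriticalFugacity (5 / 8) (b δ)‖ ≤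
          C * (‖(δ : ℂ) * triEmbed s' - (δ : ℂ) * triEmbed s‖ + δ) := by
  obtain ⟨ε, hε, hεsub⟩ := Metric.isOpen_iff.1 hΩ z hz
  set K' : Set ℂ := Metric.closedBall z (ε / 2) with hK'
  have hK'c : IsCompact K' := isCompact_closedBall _ _
  have hK'sub : K' ⊆ Ω := (Metric.closedBall_subset_ball (half_lt_self hε)).trans hεsub
  obtain ⟨C, hC⟩ := hSup K' hK'c hK'sub
  set C' : ℝ := max C 0 with hC'def
  have hC'0 : 0 ≤ C' := le_max_right _ _
  set η : ℝ := ε / 80 with hηdef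
  have hη : 0 < η := by positivity
  refine ⟨η, 6 * C', hη, by positivity, ?_⟩
  have hδev : ∀ᶠ δ : ℝ in 𝓝[>] 0, δ ∈ Set.Ioo 0 η := Ioo_mem_nhdsGT hη
  filter_upwards [hexh K' hK'c hK'sub, hC, hδev] with δ hexhδ hCδ ⟨hδ0, hδη⟩ H hH s s' hs hs'
  have hnear : ∀ (k l : ℤ) (u : ℂ), ‖u - triEmbed ![k, l]‖ ≤ 1 →
      ‖(δ : ℂ) * triEmbed ![k, l] - z‖ ≤ 19 * η → (δ : ℂ) * u ∈ K' := by
    intro k l u hu hkl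
    refine Metric.mem_closedBall.2 ?_
    rw [dist_eq_norm]
    have := norm_scaled_sub_le hδ0.le hu hkl
    have h80 : 80 * η = ε := by rw [hηdef]; ring
    linarith
  have hface : ∀ k l : ℤ, ‖(δ : ℂ) * triEmbed ![k, l] - z‖ ≤ 19 * η → upFace k l ∈ Λ δ :=
    fun k l hkl => hexhδ _ (hnear k l _ (cell_geometry k l).1 hkl)
  have key := core_link (Λ := Λ δ) (a := e δ) (b₀ := b δ) (s := s) (s' := s') (z := z)
    (C := C') hδ0 hδη.le hC'0 hs hs'
    (fun k l _ hkl => hface k l hkl)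
    (fun k l _ hkl => (hCδ _ (upEdge_mem_midEdges (hface k l hkl))
      (hnear k l _ (cell_geometry k l).2.2.1 hkl)).trans
        (mul_le_mul_of_nonneg_right (le_max_left _ _) (norm_nonneg _)))
    (fun k l _ hkl => (hCδ _ (floorEdge_mem_midEdges (hface k l hkl))
      (hnear k l _ (cell_geometry k l).2.2.2.2.1 hkl)).trans
        (mul_le_mul_of_nonneg_right (le_max_left _ _) (norm_nonneg _)))
  exact key.2 H hH

/-- **Density of lattice sites near a point of the open region**: for every `θ > 0`, eventually
some lattice site of `Λ δ` scales to within `θ` of `z` (a site within `2δ` of `z`, whose up-face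
has its scaled centre in a compact ball about `z` inside `Ω`). [folklore] -/
theorem interior_density {Λ : ℝ → Finset HexVertex} {Ω : Set ℂ} (hΩ : IsOpen Ω)
    (hexh : ∀ K : Set ℂ, IsCompact K → K ⊆ Ω →
      ∀ᶠ δ : ℝ in 𝓝[>] 0, ∀ v : HexVertex, (δ : ℂ) * hexCenter v ∈ K → v ∈ Λ δ)
    {z : ℂ} (hz : z ∈ Ω) {θ : ℝ} (hθ : 0 < θ) :
    ∀ᶠ δ : ℝ in 𝓝[>] 0, ∃ s : Site 2, IsLatticeSite (Λ δ) s ∧ ‖(δ : ℂ) * triEmbed s - z‖ < θ := by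
  obtain ⟨ε, hε, hεsub⟩ := Metric.isOpen_iff.1 hΩ z hz
  set K' : Set ℂ := Metric.closedBall z (ε / 2) with hK'
  have hK'sub : K' ⊆ Ω := (Metric.closedBall_subset_ball (half_lt_self hε)).trans hεsub
  have hδev : ∀ᶠ δ : ℝ in 𝓝[>] 0, δ ∈ Set.Ioo 0 (min (ε / 6) (θ / 3)) :=
    Ioo_mem_nhdsGT (lt_min (by positivity) (by positivity))
  filter_upwards [hexh K' (isCompact_closedBall _ _) hK'sub, hδev] with δ hexhδ ⟨hδ0, hδlt⟩
  have hδε : δ < ε / 6 := lt_of_lt_of_le hδlt (min_le_left _ _)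
  have hδθ : δ < θ / 3 := lt_of_lt_of_le hδlt (min_le_right _ _)
  obtain ⟨s, hs⟩ := exists_site_near hδ0 z
  have hsv : s = ![s 0, s 1] := by ext i; fin_cases i <;> simp
  have hs' : ‖(δ : ℂ) * triEmbed ![s 0, s 1] - z‖ ≤ 2 * δ := by rw [← hsv]; exact hs
  refine ⟨s, ⟨upFace (s 0) (s 1), hexhδ _ (Metric.mem_closedBall.2 ?_), mem_hexFaceVertices_upFace s⟩,
    by linarith⟩
  rw [dist_eq_norm]
  have h1 := norm_scaled_sub_le hδ0.le (cell_geometry (s 0) (s 1)).1 hs'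
  linarith

/-- **Registered piece `developingMapsCompact_uniqueness`** of stub `stub_developingMapsCompact`
(crux stmt-CriticalPhenomena-14004, line `pick-half-plane`): potentials are unique up to constants
on connected domains, in registry form (one `∀`-term; see `sub_eq_sub_of_preconnected`).
[cite: DuminilCopinSmirnov2012, §4 (the map H with dH = F dz)] -/
theorem developingMapsCompact_uniqueness : ∀ (Λ : Finset HexVertex) (a : Sym2 HexVertex) (H H' : Site 2 → ℂ) (s t : Site 2), (hexGraph.induce ((Λ : Finset HexVertex) : Set HexVertex)).Preconnected → IsPotential Λ a H → IsPotential Λ a H' → IsLatticeSite Λ s → IsLatticeSite Λ t → H t - H s = H' t - H' s :=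
  fun _ _ _ _ _ _ hΛ hH hH' hs ht => sub_eq_sub_of_preconnected hΛ hH hH' hs ht

end Summit.CriticalPhenomena.SAWScalingLimit.Theorems.PickHalfPlane.DevelopingMaps

end
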